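import Literature.RepresentationTheory.IsotypicEvaluation
import Mathlib.LinearAlgebra.Dimension.Finrank
import Mathlib.LinearAlgebra.Dual.Lemmas
import Mathlib.RepresentationTheory.Invariants
import Mathlib.LinearAlgebra.Dimension.Constructions
import HarnessLib

/-!
# Peeling one factor off a finite family of commuting isotypic representations: `X ≅ τ_j ⊗ Hom_{G_j}(τ_j, X)`
# with the other groups acting on the multiplicity space; the product formula for joint fixed vectors

Topic `RepresentationTheory`; namespace `Literature.RepresentationTheory`.  THEOREMS ONLY (no definition, no named fact,
no instance).  Setting: a field `k`, groups `G i` (`i : ι`), ONE `k`-space `X` carrying a family of pairwise COMMUTING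
representations `ρ i : G i → GL(X)`; at an index `j` an irreducible `τ : G_j → GL(T)` with scalar commutant such that
`ρ j` is `τ`-isotypic (`isotypicComponent k[G j] (ρ j).asModule τ.asModule = ⊤`).

* `exists_peel` — **isotypic calculus with commuting operators**: there is a `k`-space `M` (the multiplicity space
  `Hom_{G_j}(τ, X)`) with a commuting family `ρM i` (post-composition for `i ≠ j`, trivial at `j`) and a `k`-linear
  equivalence `e : T ⊗_k M ≃ X` with `e (τ g t ⊗ m) = ρ j g (e (t ⊗ m))` and `e (t ⊗ ρM i g m) = ρ i g (e (t ⊗ m))` (`i ≠ j`);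
  moreover `ρM i` is `τ_i`-isotypic whenever `ρ i` is (`i ≠ j`), and `M` embeds `G_i`-equivariantly into `X`.  (Bourbaki,
  *Algèbre* VIII §4 n°4; Bump 1997, Prop. 3.4.1–3.4.2 — `N₁ = Hom_A(M, P)` is a `B`-module and `λ : M ⊗ N₁ ≅ P`; Flath 1979,
  proof of Thm. 1.)  Stated EXISTENTIALLY (no constant introduced).
* `prod_finrank_fixedPoints_le` — **product formula**: if the joint fixed space
  `F = {x | ∀ i ∈ S, ∀ κ ∈ L i, ρ i κ x = x}` of a finite set `S` of indices (each `ρ i`, `i ∈ S`, isotypic of an irreducible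
  type `τ_i` with scalar commutant) is finite-dimensional and non-zero, then every `T_i^{L_i}` (`i ∈ S`) is finite-dimensional
  and non-zero and `∏_{i ∈ S} dim T_i^{L_i} ≤ dim F` (in fact `dim F = (∏ dim T_i^{L_i}) · dim (rest)`): Flath 1979, §2 Example 2
  ∕ Bump 1997, Thm. 3.4.4 («`(⊗ V_v)^{∏ K_v} = ⊗ V_v^{K_v}`») read through the peel, with ★ `mem_range_mapIncl_of_forall_eq`.
  This is the count that makes «admissible ⇒ `dim τ_v^{K_v} = 1` for almost all `v`» work WITHOUT any commutativity of
  Hecke algebras (a bounded `dim F` allows only `≤ log₂ dim F` indices with `dim T_i^{L_i} ≥ 2`).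

## References
* N. Bourbaki, *Algèbre*, Ch. VIII (2012 ed.), §4 n°4.
* D. Bump, *Automorphic Forms and Representations* (1997), Prop. 3.4.1, Prop. 3.4.2, Thm. 3.4.4.
* D. Flath, *Decomposition of representations into tensor products*, PSPM 33.1 (1979), Thm. 1, §2 Example 2.
-/

set_option autoImplicit false

noncomputable section

open TensorProduct
open scoped MonoidAlgebra

namespace Literature.RepresentationTheory

universe u uk uι uG

variable {k : Type uk} [Field k] {ι : Type uι} [DecidableEq ι] {G : ι → Type uG} [∀ i, Group (G i)]

/-! ## §1 The peel -/

/-- **Peeling the factor `τ_j`.**  For a commuting family `ρ i : G i → GL(X)` and an irreducible `τ : G_j → GL(T)` with scalar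
commutant such that `ρ j` is `τ`-isotypic: there are a `k`-space `M` with a commuting family `ρM` (trivial at `j`), a
`k`-linear `e : T ⊗ M ≃ X` transporting `τ ⊗ 1` to `ρ j` and `1 ⊗ ρM i` to `ρ i` (`i ≠ j`), and an injective `k`-linear
`Φ : M → X` intertwining `ρM i` with `ρ i` (`i ≠ j`); and `ρM i` is `τ_i`-isotypic whenever `ρ i` is (`i ≠ j`).
(`M = Hom_{G_j}(τ, X)` with post-composition; Bump 1997, Prop. 3.4.1–3.4.2.) [cite: Bump1997, Prop. 3.4.1] -/
theorem exists_peel {X : Type u} [AddCommGroup X] [Module k X] (ρ : ∀ i, Representation k (G i) X)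
    (hcomm : ∀ i i', i ≠ i' → ∀ (g : G i) (g' : G i') (x : X), ρ i g (ρ i' g' x) = ρ i' g' (ρ i g x))
    (j : ι) {T : Type u} [AddCommGroup T] [Module k T] (τ : Representation k (G j) T) [τ.IsIrreducible]
    (hτ : ∀ φ : τ.IntertwiningMap τ, ∃ c : k, ∀ x, φ x = c • x)
    (hiso : isotypicComponent k[G j] (ρ j).asModule τ.asModule = ⊤) :
    ∃ (M : Type u) (_ : AddCommGroup M) (_ : Module k M) (ρM : ∀ i, Representation k (G i) M)
      (e : T ⊗[k] M ≃ₗ[k] X) (Φ : M →ₗ[k] X),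
      (∀ (g : G j) (t : T) (m : M), e (τ g t ⊗ₜ[k] m) = ρ j g (e (t ⊗ₜ[k] m))) ∧
      (∀ i, i ≠ j → ∀ (g : G i) (t : T) (m : M), e (t ⊗ₜ[k] ρM i g m) = ρ i g (e (t ⊗ₜ[k] m))) ∧
      (∀ (g : G j) (m : M), ρM j g m = m) ∧
      (∀ i i', i ≠ i' → ∀ (g : G i) (g' : G i') (m : M), ρM i g (ρM i' g' m) = ρM i' g' (ρM i g m)) ∧
      Function.Injective Φ ∧ (∀ i, i ≠ j → ∀ (g : G i) (m : M), Φ (ρM i g m) = ρ i g (Φ m)) ∧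
      (∀ i, i ≠ j → ∀ {Ti : Type u} [AddCommGroup Ti] [Module k Ti] (τi : Representation k (G i) Ti) [τi.IsIrreducible],
        isotypicComponent k[G i] (ρ i).asModule τi.asModule = ⊤ →
          isotypicComponent k[G i] (ρM i).asModule τi.asModule = ⊤) := by
  classical
  -- the multiplicity space `M = Hom_{G_j}(τ, X)` as a submodule of `T →ₗ X`
  let Msub : Submodule k (T →ₗ[k] X) :=
    { carrier := {f | ∀ (g : G j) (t : T), f (τ g t) = ρ j g (f t)}
      add_mem' := fun {f f'} hf hf' g t => by simp [hf g t, hf' g t]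
      zero_mem' := fun g t => by simp
      smul_mem' := fun c f hf g t => by simp [hf g t] }
  have hMsub : ∀ {f : T →ₗ[k] X}, f ∈ Msub ↔ ∀ (g : G j) (t : T), f (τ g t) = ρ j g (f t) := fun {f} => Iff.rfl
  -- post-composition by `ρ i g` (`i ≠ j`) preserves `Msub` (the actions commute); at `j` we take the trivial action
  have hstab : ∀ i, i ≠ j → ∀ (g : G i) (f : T →ₗ[k] X), f ∈ Msub → ρ i g ∘ₗ f ∈ Msub := fun i hij g f hf g' t => by
    rw [LinearMap.comp_apply, hf g' t, LinearMap.comp_apply, hcomm i j hij]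
  let act : ∀ i, Representation k (G i) Msub := fun i =>
    if hij : i = j then 1 else
      { toFun := fun g => (LinearMap.llcomp k T X X (ρ i g)).restrict fun f hf => hstab i hij g f hf
        map_one' := by
          apply LinearMap.ext; intro f; apply Subtype.ext; apply LinearMap.ext; intro t
          simp [LinearMap.restrict_apply]
        map_mul' := fun g g' => by
          apply LinearMap.ext; intro f; apply Subtype.ext; apply LinearMap.ext; intro t
          simp [LinearMap.restrict_apply] }
  have hact_j : ∀ (g : G j) (m : Msub), act j g m = m := fun g m => by simp [act]
  have hact : ∀ i, i ≠ j → ∀ (g : G i) (m : Msub) (t : T), (act i g m : T →ₗ[k] X) t = ρ i g ((m : T →ₗ[k] X) t) :=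
    fun i hij g m t => by simp [act, hij, LinearMap.restrict_apply]
  -- the `k`-linear identification `Msub ≃ Hom_{G_j}(τ, ρ j)` and the isotypic calculus `e₀ : T ⊗ Hom ≃ X`
  let ε : Msub ≃ₗ[k] τ.IntertwiningMap (ρ j) :=
    { toFun := fun f => LinearMap.intertwiningMap_of_isIntertwiningMap τ (ρ j) (f : T →ₗ[k] X) ((hMsub).1 f.2)
      invFun := fun φ => ⟨φ.toLinearMap, fun g t => Representation.IntertwiningMap.isIntertwining _ _ φ g t⟩
      map_add' := fun f f' => Representation.IntertwiningMap.ext rfl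
      map_smul' := fun c f => Representation.IntertwiningMap.ext rfl
      left_inv := fun f => rfl
      right_inv := fun φ => Representation.IntertwiningMap.ext rfl }
  have hε : ∀ (f : Msub) (t : T), ε f t = (f : T →ₗ[k] X) t := fun f t => rfl
  obtain ⟨e₀, he₀⟩ := intertwiningMap_exists_linearEquiv_apply_tmul τ (ρ j) hτ hiso
  let e : T ⊗[k] Msub ≃ₗ[k] X := (TensorProduct.congr (LinearEquiv.refl k T) ε).trans e₀
  have he : ∀ (t : T) (m : Msub), e (t ⊗ₜ[k] m) = (m : T →ₗ[k] X) t := fun t m => by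
    simp only [e, LinearEquiv.trans_apply, TensorProduct.congr_tmul, LinearEquiv.refl_apply, he₀, hε]
  -- the embedding `Φ : M → X`, `f ↦ f t₀`
  haveI : Nontrivial T := by
    haveI : IsSimpleModule k[G j] τ.asModule := inferInstance
    exact (IsSimpleModule.nontrivial k[G j] τ.asModule)
  obtain ⟨t₀, ht₀⟩ := exists_ne (0 : T)
  let Φ : Msub →ₗ[k] X := (LinearMap.applyₗ t₀).comp Msub.subtype
  have hΦ : ∀ m : Msub, Φ m = (m : T →ₗ[k] X) t₀ := fun m => rfl
  have hΦinj : Function.Injective Φ := by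
    rw [← LinearMap.ker_eq_bot, LinearMap.ker_eq_bot']
    intro m hm
    rw [hΦ] at hm
    -- `ker m` is a non-zero subrepresentation of the irreducible `τ`, hence everything
    have hker : (ε m).ker = ⊤ := by
      refine ((IsSimpleOrder.eq_bot_or_eq_top (ε m).ker).resolve_left fun h => ht₀ ?_)
      have : t₀ ∈ (ε m).ker := by
        rw [Representation.IntertwiningMap.mem_ker]; exact hm
      rw [h] at this
      exact (Submodule.mem_bot k).1 this
    apply Subtype.ext
    apply LinearMap.ext
    intro t
    have : t ∈ (ε m).ker := by rw [hker]; trivial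
    rw [Representation.IntertwiningMap.mem_ker] at this
    exact this
  refine ⟨Msub, inferInstance, inferInstance, act, e, Φ, ?_, ?_, hact_j, ?_, hΦinj, ?_, ?_⟩
  · intro g t m
    rw [he, he]
    exact m.2 g t
  · intro i hij g t m
    rw [he, he, hact i hij]
  · intro i i' hii' g g' m
    by_cases hij : i = j
    · subst hij; rw [hact_j, hact_j]
    by_cases hi'j : i' = j
    · subst hi'j; rw [hact_j, hact_j]
    apply Subtype.ext
    apply LinearMap.ext
    intro t
    rw [hact i hij, hact i' hi'j, hact i' hi'j, hact i hij, hcomm i i' hii']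
  · intro i hij g m
    rw [hΦ, hΦ, hact i hij]
  · -- isotypy transfer along the injective `G_i`-equivariant `Φ`
    intro i hij Ti _ _ τi _ hisoi
    haveI : IsSemisimpleModule k[G i] (⊤ : Submodule k[G i] (ρ i).asModule) := hisoi ▸ inferInstance
    haveI : IsSemisimpleModule k[G i] (ρ i).asModule := IsSemisimpleModule.congr Submodule.topEquiv.symm
    have hX : IsIsotypicOfType k[G i] (ρ i).asModule τi.asModule := IsIsotypicOfType.of_isotypicComponent_eq_top hisoi
    -- `Φ` as a `k[G i]`-linear map `(act i).asModule → (ρ i).asModule`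
    let Φi : Representation.IntertwiningMap (act i) (ρ i) :=
      LinearMap.intertwiningMap_of_isIntertwiningMap (act i) (ρ i) Φ fun g m => by rw [hΦ, hΦ, hact i hij]
    let ΦA : Representation.asModule (act i) →ₗ[k[G i]] (ρ i).asModule :=
      Representation.IntertwiningMap.equivLinearMapAsModule (act i) (ρ i) Φi
    have hΦAinj : Function.Injective ΦA := fun a b h => hΦinj h
    haveI : IsSemisimpleModule k[G i] (Representation.asModule (act i)) :=
      IsSemisimpleModule.congr (LinearEquiv.ofInjective ΦA hΦAinj)
    exact isotypicComponent_eq_top_iff.2 (hX.of_injective ΦA hΦAinj)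

/-! ## §2 The product formula for joint fixed vectors -/

/-- `m ↦ t₁ ⊗ m` is injective for `t₁ ≠ 0` over a field (split by `f ⊗ 1` for a functional `f` with `f t₁ = 1`). [folklore] -/
private theorem tmul_right_injective {T M : Type*} [AddCommGroup T] [Module k T] [AddCommGroup M] [Module k M]
    {t₁ : T} (ht₁ : t₁ ≠ 0) : Function.Injective (fun m : M => t₁ ⊗ₜ[k] m) := by
  obtain ⟨f, hf⟩ := Module.Projective.exists_dual_eq_one k ht₁
  intro m m' h
  have h' := congrArg (fun z => TensorProduct.lid k M (f.rTensor M z)) h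
  simpa [hf] using h'

/-- **Product formula for the joint fixed vectors of a commuting isotypic family.**  Let `ρ i : G i → GL(X)` (`i ∈ S`, finite)
pairwise commute, each `ρ i` isotypic of an irreducible type `τ i : G i → GL(T i)` with scalar commutant, and `L i ≤ G i`.  If
the joint fixed space `F = ⋂_{i ∈ S} X^{L_i}` is finite-dimensional and non-zero, then each `(T i)^{L_i}` is finite-dimensional
and non-zero and `∏_{i ∈ S} dim (T i)^{L_i} ≤ dim F`. (Peel one factor: `F ≅ (T j)^{L_j} ⊗ F_M` by ★ `mem_range_mapIncl_of_forall_eq`;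
Flath 1979, §2 Example 2 ∕ Bump 1997, Thm. 3.4.4: `(⊗ V_v)^{∏ K_v} = ⊗ V_v^{K_v}`.) [cite: FlathCorvallis1979, §2 Example 2] -/
theorem prod_finrank_invariants_le (S : Finset ι) {T : ι → Type u} [∀ i, AddCommGroup (T i)] [∀ i, Module k (T i)]
    (τ : ∀ i, Representation k (G i) (T i)) [∀ i, (τ i).IsIrreducible]
    (hτ : ∀ i ∈ S, ∀ φ : (τ i).IntertwiningMap (τ i), ∃ c : k, ∀ x, φ x = c • x) (L : ∀ i, Subgroup (G i)) :
    ∀ (X : Type u) [AddCommGroup X] [Module k X] (ρ : ∀ i, Representation k (G i) X),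
      (∀ i i', i ≠ i' → ∀ (g : G i) (g' : G i') (x : X), ρ i g (ρ i' g' x) = ρ i' g' (ρ i g x)) →
      (∀ i ∈ S, isotypicComponent k[G i] (ρ i).asModule (τ i).asModule = ⊤) →
      FiniteDimensional k ↥(⨅ i ∈ S, Representation.invariants ((ρ i).comp (L i).subtype)) →
      (⨅ i ∈ S, Representation.invariants ((ρ i).comp (L i).subtype)) ≠ ⊥ →
        (∀ i ∈ S, FiniteDimensional k ↥(Representation.invariants ((τ i).comp (L i).subtype)) ∧ Representation.invariants ((τ i).comp (L i).subtype) ≠ ⊥) ∧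
        ∏ i ∈ S, Module.finrank k ↥(Representation.invariants ((τ i).comp (L i).subtype)) ≤
          Module.finrank k ↥(⨅ i ∈ S, Representation.invariants ((ρ i).comp (L i).subtype)) := by
  classical
  induction S using Finset.induction_on with
  | empty =>
    intro X _ _ ρ _ _ hfin hne
    refine ⟨fun i hi => absurd hi (Finset.notMem_empty i), ?_⟩
    rw [Finset.prod_empty]
    haveI := hfin
    exact Nat.one_le_iff_ne_zero.2 fun h => hne (Submodule.finrank_eq_zero.1 h)
  | insert j S' hj IH =>
    intro X _ _ ρ hcomm hiso hfin hne
    -- notation for the fixed spaces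
    set F : Submodule k X := ⨅ i ∈ insert j S', Representation.invariants ((ρ i).comp (L i).subtype) with hFdef
    have hF : ∀ x, x ∈ F ↔ ∀ i ∈ insert j S', ∀ κ ∈ L i, ρ i κ x = x := fun x => by
      simp only [hFdef, Submodule.mem_iInf, Representation.mem_invariants]
      exact ⟨fun h i hi κ hκ => h i hi ⟨κ, hκ⟩, fun h i hi κ => h i hi κ κ.2⟩
    set P : Submodule k (T j) := Representation.invariants ((τ j).comp (L j).subtype) with hPdef
    have hP : ∀ t, t ∈ P ↔ ∀ κ ∈ L j, τ j κ t = t := fun t => by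
      simp only [hPdef, Representation.mem_invariants]
      exact ⟨fun h κ hκ => h ⟨κ, hκ⟩, fun h κ => h κ κ.2⟩
    -- peel the factor `j`
    obtain ⟨M, _, _, ρM, e, Φ, he_j, he_i, hMj, hMcomm, hΦinj, hΦ, hMiso⟩ :=
      exists_peel ρ hcomm j (τ j) (hτ j (Finset.mem_insert_self j S')) (hiso j (Finset.mem_insert_self j S'))
    set Q : Submodule k M := ⨅ i ∈ S', Representation.invariants ((ρM i).comp (L i).subtype) with hQdef
    have hQ : ∀ m, m ∈ Q ↔ ∀ i ∈ S', ∀ κ ∈ L i, ρM i κ m = m := fun m => by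
      simp only [hQdef, Submodule.mem_iInf, Representation.mem_invariants]
      exact ⟨fun h i hi κ hκ => h i hi ⟨κ, hκ⟩, fun h i hi κ => h i hi κ κ.2⟩
    -- `e` is equivariant on all tensors
    have he_j' : ∀ (κ : G j) (z : T j ⊗[k] M), e ((τ j κ).rTensor M z) = ρ j κ (e z) := fun κ z => by
      induction z using TensorProduct.induction_on with
      | zero => simp
      | tmul t m => rw [LinearMap.rTensor_tmul, he_j]
      | add a b ha hb => rw [map_add, map_add, ha, hb, map_add, map_add]
    have he_i' : ∀ i, i ≠ j → ∀ (κ : G i) (z : T j ⊗[k] M), e ((ρM i κ).lTensor (T j) z) = ρ i κ (e z) := fun i hij κ z => by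
      induction z using TensorProduct.induction_on with
      | zero => simp
      | tmul t m => rw [LinearMap.lTensor_tmul, he_i i hij]
      | add a b ha hb => rw [map_add, map_add, ha, hb, map_add, map_add]
    -- `F = e (P ⊗ Q)`
    have hFPQ : F = (LinearMap.range (TensorProduct.mapIncl P Q)).map (e : T j ⊗[k] M →ₗ[k] X) := by
      apply le_antisymm
      · intro x hx
        rw [hF] at hx
        refine ⟨e.symm x, ?_, e.apply_symm_apply x⟩
        refine mem_range_mapIncl_of_forall_eq P Q {f | ∃ κ ∈ L j, f = τ j κ}
          {f | ∃ i ∈ S', ∃ κ ∈ L i, f = ρM i κ} (fun t ht => (hP t).2 fun κ hκ => ht _ ⟨κ, hκ, rfl⟩)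
          (fun m hm => (hQ m).2 fun i hi κ hκ => hm _ ⟨i, hi, κ, hκ, rfl⟩) (e.symm x) ?_ ?_
        · rintro _ ⟨κ, hκ, rfl⟩
          apply e.injective
          rw [he_j', e.apply_symm_apply, hx j (Finset.mem_insert_self j S') κ hκ]
        · rintro _ ⟨i, hi, κ, hκ, rfl⟩
          apply e.injective
          rw [he_i' i (ne_of_mem_of_not_mem hi hj), e.apply_symm_apply, hx i (Finset.mem_insert_of_mem hi) κ hκ]
      · rintro _ ⟨z, ⟨y, rfl⟩, rfl⟩
        rw [LinearEquiv.coe_coe, hF]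
        intro i hi κ hκ
        induction y using TensorProduct.induction_on with
        | zero => simp
        | tmul t m =>
          rw [TensorProduct.mapIncl, TensorProduct.map_tmul, Submodule.coe_subtype, Submodule.coe_subtype]
          rcases Finset.mem_insert.1 hi with rfl | hi'
          · rw [← he_j, (hP t.1).1 t.2 κ hκ]
          · rw [← he_i i (ne_of_mem_of_not_mem hi' hj), (hQ m.1).1 m.2 i hi' κ hκ]
        | add a b ha hb => rw [map_add, map_add, map_add, ha, hb]
    -- `P ⊗ Q ≅ F`, hence the dimension count
    have hincl : Function.Injective (TensorProduct.mapIncl P Q) := by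
      rw [TensorProduct.mapIncl, ← LinearMap.rTensor_comp_lTensor]
      exact (Module.Flat.rTensor_preserves_injective_linearMap _ P.subtype_injective).comp
        (Module.Flat.lTensor_preserves_injective_linearMap _ Q.subtype_injective)
    let ePQ : (↥P ⊗[k] ↥Q) ≃ₗ[k] F :=
      (LinearEquiv.ofInjective _ hincl).trans
        (((LinearMap.range (TensorProduct.mapIncl P Q)).equivMapOfInjective _ e.injective).trans (LinearEquiv.ofEq _ _ hFPQ.symm))
    haveI : FiniteDimensional k F := hfin
    haveI : FiniteDimensional k (↥P ⊗[k] ↥Q) := LinearEquiv.finiteDimensional ePQ.symm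
    haveI hPQne : Nontrivial (↥P ⊗[k] ↥Q) := by
      haveI : Nontrivial F := Submodule.nontrivial_iff_ne_bot.2 hne
      exact ePQ.toEquiv.nontrivial
    -- both factors are non-zero and finite-dimensional
    have hPne : P ≠ ⊥ := by
      intro h
      have : Subsingleton (↥P ⊗[k] ↥Q) := by
        haveI : Subsingleton P := by rw [h]; infer_instance
        infer_instance
      exact not_subsingleton _ this
    have hQne : Q ≠ ⊥ := by
      intro h
      have : Subsingleton (↥P ⊗[k] ↥Q) := by
        haveI : Subsingleton Q := by rw [h]; infer_instance
        infer_instance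
      exact not_subsingleton _ this
    haveI : Nontrivial P := Submodule.nontrivial_iff_ne_bot.2 hPne
    haveI : Nontrivial Q := Submodule.nontrivial_iff_ne_bot.2 hQne
    obtain ⟨p₁, hp₁⟩ := exists_ne (0 : P)
    obtain ⟨q₁, hq₁⟩ := exists_ne (0 : Q)
    haveI : FiniteDimensional k Q :=
      Module.Finite.of_injective (TensorProduct.mk k P Q p₁) (tmul_right_injective hp₁)
    haveI : FiniteDimensional k P :=
      Module.Finite.of_injective ((TensorProduct.mk k P Q).flip q₁) fun p p' h =>
        tmul_right_injective (M := P) hq₁ (by simpa using congrArg (TensorProduct.comm k P Q) h)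
    -- induction hypothesis on the multiplicity space
    obtain ⟨hIH₁, hIH₂⟩ := IH (fun i hi => hτ i (Finset.mem_insert_of_mem hi)) M ρM hMcomm
      (fun i hi => hMiso i (ne_of_mem_of_not_mem hi hj) (τ i) (hiso i (Finset.mem_insert_of_mem hi))) inferInstance hQne
    refine ⟨fun i hi => ?_, ?_⟩
    · rcases Finset.mem_insert.1 hi with rfl | hi'
      · exact ⟨inferInstance, hPne⟩
      · exact hIH₁ i hi'
    · rw [Finset.prod_insert hj, ← ePQ.finrank_eq, Module.finrank_tensorProduct]
      exact Nat.mul_le_mul_left _ hIH₂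

end Literature.RepresentationTheory

end
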